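import Literature.AlgebraicGeometry.Motives.LinesGenerateChowOneSumSq
import Literature.AlgebraicGeometry.Motives.LinesGenerateChowOneLinear
import HarnessLib

/-!
# Lines generate `CH₁` of a subscheme of `ℙᴺ` of small multidegree containing a large linear space

Paranjape, *Cohomological and cycle-theoretic connectivity* (Ann. of Math. 139 (1994)), §4.2, shows
that `CH₁` of an intersection `X = V₊(F₁, …, F_c) ⊆ ℙᴺ` of small multidegree is `ℤ · [line]` by
blowing up a linear space `Λ ≅ ℙˡ ⊆ X`, projecting, and applying Tsen–Lang on the fibres (proof of
Lemma 4.2.4; the numerics there are recursive and only asserted to be finite, Thm. 4.2.5). This file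
proves the one-dimensional case of that mechanism with an explicit bound, in the product-trick form
of Tian–Zong (*One-cycles on rationally connected varieties*, Compositio Math. 150 (2014), proof of
Prop. 7.2, formalized in `Motives/LinesGenerateChowOneSumSq`):

**Theorem** (`chowOneGeneratedByLines_of_linearSubspace`). Let `k` be algebraically closed,
`X ⊆ ℙᴺ_k` a closed subscheme whose underlying set is `V₊(F₁, …, F_c)` for forms of degrees
`d_a ≥ 1`, and suppose `X` contains a linear subspace `Λ = V₊(L₁, …, L_t)` (`L` independent linear
forms) with `Σ_a d_a (d_a - 1) / 2 + t < N + 1`, i.e. `dim Λ ≥ Σ_a binom(d_a, 2)`. Then every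
`1`-cycle on `X` is rationally equivalent to an integral combination of lines of `X`
(`ChowOneGeneratedByLines N i`).

Proof. Let `C ⊆ X` be an integral curve, `B = C^ν` its normalization, `K = k(B)`; the generic point
of `C` is a `K`-point `[p]` of `X_K`. A `K`-point `[r]` of `Λ_K` with the line `p r` on `X_K` is a
non-trivial zero, in the `dim Λ + 1` homogeneous coordinates of `Λ`, of the `s^e`-coefficients
(`1 ≤ e ≤ d_a - 1`) of `F_a(s p + r)` — forms of degrees `d_a - e` with degree sum
`Σ_a binom(d_a, 2) < dim Λ + 1` (the extreme coefficients vanish: `F_a(p) = 0`, and `F_a(r) = 0`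
because `Λ ⊆ X`); it exists by Tsen's theorem (`K` is `C₁`,
`Literature.FieldTheory.QuasiAlgClosed.TsenSystems`) — `exists_line_to_coordSubspace`. The closure
of the line `p r` in `X ×ₖ B` is a surface ruled over `B` on which the sections through `p` and `r`
are rationally equivalent modulo vertical lines (`ProjFamily.exists_relation_of_line`, the
ruled-surface lemma of `Motives/RuledSurfaceRelation`). Pushing forward to `X` (Fulton Thm. 1.4),
the section through `p` gives `[C]`, and the section through `r` gives a multiple of a curve inside
`Λ ≅ ℙˡ`, where `CH₁ = ℤ · [line]` along the coordinate flag (`Motives/ChowProjectiveSpaceLines`,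
Fulton Ex. 1.9.3) — `ProjFamily.exists_zsmul_line_of_mem_coordSubspace`. We first treat
`Λ = V₊(x_{l+1}, …, x_N)` (`ProjFamily.exists_lines_of_birational_curve_of_coordSubspace`,
`chowOneGeneratedByLines_of_coordSubspace`) and reduce to it by a projective linear change of
coordinates (`Motives/ProjectiveSpaceLinearSubst`, `Motives/LinesGenerateChowOneLinear`).

For the named fact `TianZong2014_chowOne_generatedByLines` (smooth complete intersections with
`Σ d_a ≤ N - 1`) this covers, beyond the range `Σ d_a² ≤ N` of `Motives/LinesGenerateChowOneSumSq`,
exactly the `X` containing a linear `ℙˡ` with `l ≥ Σ_a binom(d_a, 2)`: e.g. cubic hypersurfaces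
containing a `ℙ³`, intersections of two quadrics containing a plane.

Everything is proved; the only definitions are the coordinate bookkeeping `extVec`, `restrSubst`.

## References

* [Paranjape1994SmallChow] K. H. Paranjape, *Cohomological and cycle-theoretic connectivity*,
  Ann. of Math. 139 (1994), §4.2, Lemma 4.2.4 and its proof.
* [TianZong2014] Z. Tian, H. R. Zong, *One-cycles on rationally connected varieties*, Compositio
  Math. 150 (2014), Prop. 7.2 and its proof; Thm. 1.7.
* [Fulton1998] W. Fulton, *Intersection Theory*, Thm. 1.4, Example 1.9.3.
-/

noncomputable section

open CategoryTheory CategoryTheory.Limits AlgebraicGeometry MonoidalCategory MvPolynomial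
  TopologicalSpace Order

universe u

namespace Literature.AlgebraicGeometry.Motives

attribute [local instance] MvPolynomial.gradedAlgebra MvPolynomial.algebraMvPolynomial
  Literature.AlgebraicGeometry.Motives.ProjBaseChange.algebraBase
  UniversalHyperplaneSection.sectionsAlgebra ProjFamily.functionFieldAlgebra

namespace ProjFamily

open ProjBaseChangeRing ProjectiveSpaceCells ProjectiveSpace Literature.RingTheory.MvPolynomial

/-! ### Coordinates on the coordinate subspace `Λ_l = V(x_{l+1}, …, x_N)` -/

section Coordinates

variable {K : Type u} [Field K] {N : ℕ}

/-- Extension by zero `K^{l+1} → K^{N+1}`, `(x₀, …, x_l) ↦ (x₀, …, x_l, 0, …, 0)`: homogeneous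
coordinates of the points of the coordinate subspace `Λ_l = V(x_{l+1}, …, x_N)`. [folklore] -/
def extVec (l : ℕ) (x : Fin (l + 1) → K) : Fin (N + 1) → K :=
  fun m => if h : (m : ℕ) < l + 1 then x ⟨m, h⟩ else 0

/-- The substitution `x_m ↦ x_m` (`m ≤ l`), `x_m ↦ 0` (`m > l`): restriction of forms to `Λ_l` in its
`l + 1` homogeneous coordinates. [folklore] -/
def restrSubst (K : Type u) [Field K] (N l : ℕ) : Fin (N + 1) → MvPolynomial (Fin (l + 1)) K :=
  fun m => if h : (m : ℕ) < l + 1 then X ⟨m, h⟩ else 0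

/-- `restrSubst` evaluated at `x` is the extension by zero of `x`. [folklore] -/
theorem eval_restrSubst {l : ℕ} (x : Fin (l + 1) → K) (m : Fin (N + 1)) :
    eval x (restrSubst K N l m) = extVec l x m := by
  unfold restrSubst extVec
  split_ifs with h
  · exact eval_X _
  · exact map_zero _

/-- The substituted variables are linear forms. [folklore] -/
theorem isHomogeneous_restrSubst (l : ℕ) (m : Fin (N + 1)) :
    (restrSubst K N l m).IsHomogeneous 1 := by
  unfold restrSubst
  split_ifs
  · exact isHomogeneous_X K _
  · exact isHomogeneous_zero _ _ _

/-- `restrSubst` is compatible with extension of scalars. [folklore] -/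
theorem map_restrSubst {K' : Type u} [Field K'] (f : K →+* K') (l : ℕ) (m : Fin (N + 1)) :
    MvPolynomial.map f (restrSubst K N l m) = restrSubst K' N l m := by
  unfold restrSubst
  split_ifs
  · exact map_X f _
  · exact map_zero _

/-- `(G|Λ)(x) = G(ext x)`: evaluating the restriction at `x ∈ K^{l+1}` is evaluating `G` at the
extension by zero. [folklore] -/
theorem eval_bind₁_restrSubst {l : ℕ} (x : Fin (l + 1) → K) (G : MvPolynomial (Fin (N + 1)) K) :
    eval x (bind₁ (restrSubst K N l) G) = eval (extVec l x) G := by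
  rw [show eval x (bind₁ (restrSubst K N l) G) =
      eval₂Hom (RingHom.id K) x (bind₁ (restrSubst K N l) G) from rfl, eval₂Hom_bind₁]
  have hfun : (fun m => eval₂Hom (RingHom.id K) x (restrSubst K N l m)) = extVec l x :=
    funext fun m => eval_restrSubst x m
  rw [hfun]
  rfl

/-- The extension by zero of a non-zero vector is non-zero (`l ≤ N`). [folklore] -/
theorem extVec_ne_zero {l : ℕ} (hl : l ≤ N) {x : Fin (l + 1) → K} (hx : x ≠ 0) :
    extVec (N := N) l x ≠ 0 := by
  obtain ⟨j, hj⟩ := Function.ne_iff.mp hx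
  refine Function.ne_iff.mpr ⟨⟨j, by omega⟩, ?_⟩
  have h : ((⟨j, by omega⟩ : Fin (N + 1)) : ℕ) < l + 1 := j.2
  simp only [extVec, Fin.is_lt, ↓reduceDIte, Fin.eta, Pi.zero_apply]
  exact hj

/-- The extension by zero vanishes beyond `l`. [folklore] -/
theorem extVec_apply_of_lt {l : ℕ} (x : Fin (l + 1) → K) {m : Fin (N + 1)} (hm : l < (m : ℕ)) :
    extVec l x m = 0 := by
  simp only [extVec]
  rw [dif_neg (by omega)]

/-- The extension by zero of `0` is `0`. [folklore] -/
theorem extVec_zero (l : ℕ) : extVec (N := N) l (0 : Fin (l + 1) → K) = 0 := by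
  funext m
  simp only [extVec, Pi.zero_apply, dite_eq_ite, ite_self]

end Coordinates

/-! ### One line from a zero of the system to the coordinate subspace (Tsen step) -/

section LineToPlane

variable {K : Type u} [Field K] {N : ℕ}

/-- **A line from a zero `p` to the linear subspace `Λ_l ⊆ V(F)`** (the algebra of the
one-dimensional case of Paranjape's Lemma 4.2.4, in the form used with Tian–Zong's product trick).
Let `F_a` be forms of degrees `d_a` in `N + 1` variables over a field `K` vanishing identically on
the coordinate subspace `Λ_l = V(x_{l+1}, …, x_N)` (`hFΛ`), and assume every finite system of forms
of positive degrees `e_j` in `l + 1` variables with `Σ e_j < l + 1` has a non-trivial zero over `K`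
(`hK`; Tsen–Lang for `K` of transcendence degree one over an algebraically closed field). If
`Σ_a (1 + 2 + ⋯ + (d_a - 1)) < l + 1` then for every common zero `p` of the `F_a` there is a point
`r ≠ 0` of `Λ_l` with `F_a(s p + t r) = 0` for all `s, t` and all `a`: the line `p r` lies on `V(F)`
and meets `Λ_l`. The unknowns are the `l + 1` coordinates of `r`; the equations are the
`s^e`-coefficients, `1 ≤ e ≤ d_a - 1`, of `F_a(s p + r)` (the coefficient of `s^{d_a}` is
`F_a(p) = 0`, that of `s⁰` is `F_a(r) = 0` because `r ∈ Λ_l ⊆ V(F)`).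
[cite: Paranjape1994SmallChow, §4.2, proof of Lemma 4.2.4]
[cite: TianZong2014, proof of Prop. 7.2] -/
theorem exists_line_to_coordSubspace {l : ℕ}
    (hK : ∀ {ι : Type} [Fintype ι] (g : ι → MvPolynomial (Fin (l + 1)) K) (e : ι → ℕ),
      (∀ j, 0 < e j) → (∀ j, (g j).IsHomogeneous (e j)) → ∑ j, e j < l + 1 →
      ∃ x : Fin (l + 1) → K, x ≠ 0 ∧ ∀ j, eval x (g j) = 0)
    {c : ℕ} {F : Fin c → MvPolynomial (Fin (N + 1)) K} {d : Fin c → ℕ}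
    (hF : ∀ a, (F a).IsHomogeneous (d a))
    (hFΛ : ∀ a, bind₁ (restrSubst K N l) (F a) = 0)
    (hcount : ∑ a, ∑ i : Fin (d a - 1), (d a - 1 - (i : ℕ)) < l + 1)
    {p : Fin (N + 1) → K} (hp : ∀ a, eval p (F a) = 0) :
    ∃ x : Fin (l + 1) → K, x ≠ 0 ∧ ∀ a (s t : K), eval (s • p + t • extVec l x) (F a) = 0 := by
  classical
  -- the system: `s^{i+1}`-coefficients of `F_a(s p + y)` restricted to `Λ_l`, `i < d_a - 1`
  let J : Type := Σ a : Fin c, Fin (d a - 1)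
  let g : J → MvPolynomial (Fin (l + 1)) K := fun x =>
    bind₁ (restrSubst K N l) (coeff (Finsupp.single 0 ((x.2 : ℕ) + 1)) (linePoly p (F x.1)))
  let e : J → ℕ := fun x => d x.1 - 1 - (x.2 : ℕ)
  have he : ∀ j, 0 < e j := by
    rintro ⟨a, i⟩
    change 0 < d a - 1 - (i : ℕ); have := i.2; omega
  have hg : ∀ j, (g j).IsHomogeneous (e j) := by
    rintro ⟨a, i⟩
    have h := (isBihom_linePoly p (hF a) (Finsupp.single 0 ((i : ℕ) + 1))).1
    rw [Finsupp.degree_single] at h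
    have h' := h.aeval (restrSubst K N l) (isHomogeneous_restrSubst (K := K) (N := N) l)
    rw [one_mul] at h'
    change (bind₁ (restrSubst K N l) (coeff (Finsupp.single 0 ((i : ℕ) + 1))
      (linePoly p (F a)))).IsHomogeneous (d a - 1 - (i : ℕ))
    have hdeg : d a - 1 - (i : ℕ) = d a - ((i : ℕ) + 1) := by omega
    rw [hdeg]
    exact h'
  have hcount' : ∑ j, e j < l + 1 := by
    refine lt_of_le_of_lt (le_of_eq ?_) hcount
    rw [Fintype.sum_sigma]
  obtain ⟨x, hx0, hx⟩ := hK g e he hg hcount'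
  refine ⟨x, hx0, fun a s t => ?_⟩
  -- verification (as in `exists_two_line_chain`)
  set r : Fin (N + 1) → K := extVec l x with hr
  have hFr : ∀ a, eval r (F a) = 0 := fun a => by
    rw [hr, ← eval_bind₁_restrSubst, hFΛ a, map_zero]
  have hcoef : ∀ a (i : Fin (d a - 1)),
      eval r (coeff (Finsupp.single 0 ((i : ℕ) + 1)) (linePoly p (F a))) = 0 := fun a i => by
    rw [hr, ← eval_bind₁_restrSubst]
    exact hx ⟨a, i⟩
  have hv : ∀ α ∈ (linePoly p (F a)).support, α.degree < d a →
      eval r (coeff α (linePoly p (F a))) = 0 := by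
    intro α _ hα
    rw [finsupp_fin_one_eq_single α]
    rcases Nat.eq_zero_or_pos α.degree with h0 | hpos
    · rw [h0, Finsupp.single_zero, eval_coeff_zero_linePoly]
      exact hFr a
    · obtain ⟨m, hm⟩ := Nat.exists_eq_succ_of_ne_zero hpos.ne'
      have hlt : m < d a - 1 := by omega
      rw [hm]
      exact hcoef a ⟨m, hlt⟩
  have key := eval_eval_smul_eq_of_isBihom_of_degree (isBihom_linePoly p (hF a)) hv
    (fun _ => s) t
  rw [eval_eval_linePoly, eval_eval_linePoly, add_zero, eval_smul_of_isHomogeneous (hF a), hp a,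
    mul_zero] at key
  exact key

/-- The degree count `Σ_{i < d-1} (d - 1 - i) = binom(d, 2)`: the condition of
`exists_line_to_coordSubspace` reads `Σ_a binom(d_a, 2) < l + 1`. [folklore] -/
theorem sum_fin_sub_eq_choose (d : ℕ) : ∑ i : Fin (d - 1), (d - 1 - (i : ℕ)) = d.choose 2 := by
  have h := two_mul_sum_fin_sub (d - 1)
  rw [Nat.choose_two_right]
  rcases Nat.eq_zero_or_pos d with rfl | hd
  · simp
  · obtain ⟨d, rfl⟩ := Nat.exists_eq_add_one_of_ne_zero hd.ne'
    simp only [Nat.add_sub_cancel] at h ⊢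
    rw [mul_comm (d + 1) d, ← h, Nat.mul_div_cancel_left _ two_pos]

end LineToPlane

/-! ### `1`-cycles of `X` inside a linear subspace `Λ ⊆ X` are multiples of lines -/

section PlaneCycles

variable {k : Type u} [Field k] {N : ℕ} (X : SchemeOver k) (i : X ⟶ projectiveSpace N k)
  [IsClosedImmersion i.left] [LocallyOfFiniteType X.hom]

/-- The support of `Σ_{y ∈ s} w_y · [closure {y}]` is contained in `s`. [folklore] -/
theorem support_sum_zsmul_primeCycle_subset {Y : Scheme.{u}} (s : Finset Y) (w : Y → ℤ) :
    Function.support (∑ y ∈ s, w y • primeCycle y : AlgebraicCycle Y ℤ) ⊆ (s : Set Y) := by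
  classical
  intro x hx
  by_contra hxs
  apply hx
  change (∑ y ∈ s, w y • primeCycle y : AlgebraicCycle Y ℤ) x = 0
  rw [Function.locallyFinsuppWithin.coe_sum, Finset.sum_apply]
  refine Finset.sum_eq_zero fun y hy => ?_
  have hxy : x ≠ y := fun h => hxs (h ▸ hy)
  change (w y • primeCycle y : AlgebraicCycle Y ℤ) x = 0
  rw [Function.locallyFinsuppWithin.coe_zsmul, Pi.smul_apply, primeCycle_apply_of_ne hxy, smul_zero]

/-- **`1`-cycles of `X` inside a linear subspace of `X` are multiples of lines.** Let `X ⊆ ℙᴺ_k` be a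
closed subscheme containing the coordinate subspace `Λ_l = V₊(x_{l+1}, …, x_N)` (`l ≤ N`) and let
`x ∈ X` be a point of dimension `1` with `i(x) ∈ Λ_l` (an integral curve `C ⊆ X` lying in `Λ_l`).
Then `[C] ~ a · [ℓ]` in `Rat₁(X)` for a line `ℓ` of `X` and `a ∈ ℤ`: on the integral closed
subscheme `Λ' = i⁻¹ Λ_l ≅ Λ_l` of `X` every `1`-cycle is a multiple of the coordinate line along the
coordinate flag (`Motives/ChowProjectiveSpaceLines`, Fulton Ex. 1.9.3), and proper push-forward
along `Λ' ↪ X` preserves rational equivalence (Fulton Thm. 1.4).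
[cite: Fulton1998, Example 1.9.3 and Thm. 1.4] -/
theorem exists_zsmul_line_of_mem_coordSubspace {l : ℕ} (hl : l ≤ N)
    (hΛ : coordSubspace k N l ⊆ Set.range i.left.base) {x : ↥X.left} (hx : height x = 1)
    (hxΛ : i.left.base x ∈ coordSubspace k N l) :
    ∃ (y : ↥X.left) (a : ℤ), IsLinePoint N i y ∧
      IsRationallyEquivalent (primeCycle x) (a • primeCycle y) 1 := by
  classical
  -- the point of `X` over the generic point of `Λ_l`, and the subvariety `Λ' = i⁻¹ Λ_l`
  obtain ⟨yΛ, hyΛ⟩ : coordGenericPoint k (n := N) l ∈ Set.range i.left.base :=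
    hΛ (coordGenericPoint_mem k l)
  let Λ' : ClosedSubvariety X.left := ClosedSubvariety.ofPoint X.left yΛ
  let i' : X.left ⟶ Proj (homogeneousSubmodule (Fin (N + 1)) k) := i.left
  haveI : IsClosedImmersion i' := ‹IsClosedImmersion i.left›
  let e : Λ'.carrier ⟶ Proj (homogeneousSubmodule (Fin (N + 1)) k) := Λ'.ι ≫ i'
  have hrangeι : Set.range Λ'.ι.base = closure {yΛ} := ClosedSubvariety.range_ofPoint_ι yΛ
  have hyΛ' : i'.base yΛ = coordGenericPoint k l := hyΛ
  have hrange : Set.range e.base = coordSubspace k N l := by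
    rw [Scheme.Hom.comp_base, TopCat.coe_comp, Set.range_comp, hrangeι,
      ← i'.isClosedEmbedding.closure_image_eq, Set.image_singleton, hyΛ', closure_coordGenericPoint]
  -- `x = Λ'.ι x'`
  obtain ⟨x', hx'⟩ : i.left.base x ∈ Set.range e.base := by rw [hrange]; exact hxΛ
  have hιx' : Λ'.ι.base x' = x := i.left.isClosedEmbedding.injective hx'
  have hx'1 : height x' = 1 := by
    rw [← height_base_eq_of_isClosedImmersion' Λ'.ι x', hιx', hx]
  have hex' : height (e.base x') = 1 := by
    rw [height_base_eq_of_isClosedImmersion' e x', hx'1]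
  -- `1 ≤ l`: `Λ_l` contains the curve `e(x')`
  have hl1 : 1 ≤ l := by
    have hmem : e.base x' ∈ coordSubspace k N l := hrange ▸ ⟨x', rfl⟩
    by_cases hne : e.base x' = coordGenericPoint k l
    · have h := hex'
      rw [hne, height_coordGenericPoint k hl] at h
      exact_mod_cast h.ge
    · have h := height_lt_of_mem_coordSubspace k hl hmem hne
      rw [hex'] at h
      exact_mod_cast h.le
  obtain ⟨l', rfl⟩ : ∃ l', l = l' + 1 := ⟨l - 1, by omega⟩
  -- `CH₁` along the coordinate flag on `Λ' ≅ Λ_l`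
  obtain ⟨y', a, hy', hrat⟩ := exists_isRationallyEquivalent_zsmul_of_range_eq_coordSubspace k 1
    l' (by omega) e hrange (primeCycle x') (primeCycle_mem_cyclesOfDim (by simpa using hx'1))
  -- proper push-forward along `Λ' ↪ X`
  let ΛO : SchemeOver k := Over.mk (Λ'.ι ≫ X.hom)
  let ιO : ΛO ⟶ X := Over.homMk Λ'.ι rfl
  haveI : LocallyOfFiniteType ΛO.hom := inferInstanceAs (LocallyOfFiniteType (Λ'.ι ≫ X.hom))
  haveI : IsProper ιO.left := inferInstanceAs (IsProper Λ'.ι)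
  haveI : LocallyOfFiniteType (Λ'.ι ≫ X.hom) := inferInstance
  let M : AlgebraicCycle Λ'.carrier ℤ →+ AlgebraicCycle X.left ℤ :=
    AddMonoidHom.mk' (AlgebraicCycle.map Λ'.ι height height) (algebraicCycleMap_add _ height height)
  have hM : ∀ v : Λ'.carrier, M (primeCycle v) = primeCycle (Λ'.ι.base v) := fun v =>
    algebraicCycleMap_primeCycle_of_residueFieldMap_surjective Λ'.ι X.hom v
      (residueFieldMap_surjective_of_isPreimmersion Λ'.ι v)
  have hpush : M (primeCycle x' - a • primeCycle y') ∈ ratTrivial X.left 1 :=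
    map_mem_ratTrivial_holds (d := 1) ιO hrat
  rw [map_sub, map_zsmul, hM, hM, hιx'] at hpush
  refine ⟨Λ'.ι.base y', a, ?_, hpush⟩
  -- `Λ'.ι y'` is a line point of `X`: its image is the coordinate line `Λ₁`
  have hey' : i'.base (Λ'.ι.base y') = coordGenericPoint k 1 := hy'
  refine ⟨?_, coordForms k N 1, linearIndependent_coordForms k N 1, isHomogeneous_coordForms k N 1,
    ?_⟩
  · rw [← height_base_eq_of_isClosedImmersion' i' (Λ'.ι.base y'), hey',
      height_coordGenericPoint k (show 1 ≤ N by omega), Nat.cast_one]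
  · change ⇑i'.base '' closure {Λ'.ι.base y'} = _
    rw [← i'.isClosedEmbedding.closure_image_eq, Set.image_singleton, hey',
      closure_coordGenericPoint, coordSubspace_eq_zeroLocus_range]

end PlaneCycles

/-! ### The relation for a curve: one line to `Λ`, then the ruled surface -/

section Main

variable {k : Type u} [Field k] [IsAlgClosed k] {N : ℕ} (B : SchemeOver k) [IsIntegral B.left]
  [IsProper B.hom] (X : SchemeOver k) (i : X ⟶ projectiveSpace N k) [IsClosedImmersion i.left]

omit [IsAlgClosed k] [IsProper B.hom] [IsClosedImmersion i.left] in
/-- For a point `u` of the generic fibre `X_K`, `i (pr₁ (ι u)) = (ℙᴺ_K → ℙᴺ_k) (i_K u)`. [folklore] -/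
theorem i_fst_ιX_apply (u : ↥(XK B X)) :
    i.left.base ((CartesianMonoidalCategory.fst X B).left.base ((ιX B X).base u)) =
      (Proj.map (mapGraded k B.left.functionField (Fin (N + 1)))
        (irrelevant_le_map k B.left.functionField (Fin (N + 1)))).base ((iK N B X i).base u) := by
  have h2 : (Proj.map (mapGraded k B.left.functionField (Fin (N + 1)))
      (irrelevant_le_map k B.left.functionField (Fin (N + 1)))).base ((iK N B X i).base u) =
      ((iK N B X i ≫ genericFibreι N B ≫
        (CartesianMonoidalCategory.fst (projectiveSpace N k) B).left).base u) := by
    rw [genericFibreι_fst]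
    rfl
  rw [h2]
  change ((ιX B X ≫ (CartesianMonoidalCategory.fst X B).left ≫ i.left).base u) = _
  rw [← whiskerRight_left_fst N B X i, ← Category.assoc (ιX B X), ← iK_genericFibreι N B X i,
    Category.assoc]

omit [IsAlgClosed k] [IsProper B.hom] [IsClosedImmersion i.left] in
/-- A point of `X_K` with homogeneous coordinates `v`, `v_j = 0` for `j > l`, lies over `Λ_l`:
`i (pr₁ (ι u)) ∈ Λ_l`. [folklore] -/
theorem i_fst_ιX_mem_coordSubspace {l : ℕ} (u : ↥(XK B X)) (v : Fin (N + 1) → B.left.functionField)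
    (hv : v ≠ 0) (hu : (iK N B X i).base u = (pointOfVec B.left.functionField v hv).pt)
    (hvj : ∀ j : Fin (N + 1), l < (j : ℕ) → v j = 0) :
    i.left.base ((CartesianMonoidalCategory.fst X B).left.base ((ιX B X).base u)) ∈
      coordSubspace k N l := by
  rw [i_fst_ιX_apply, hu]
  rintro _ ⟨j, hj, rfl⟩
  change MvPolynomial.X j ∈ ProjectiveSpectrum.asHomogeneousIdeal _
  rw [ProjectiveSpectrum.mem_asHomogeneousIdeal_map_iff]
  change MvPolynomial.map (algebraMap k B.left.functionField) (MvPolynomial.X j) ∈ _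
  rw [map_X]
  exact mem_asHomogeneousIdeal_pt_pointOfVec hv one_pos (isHomogeneous_X _ j)
    (by rw [eval_X]; exact hvj j hj)

/-- **The product-trick relation with a linear subspace** (Paranjape's mechanism in Tian–Zong's
form). Let `X = V₊(F) ⊆ ℙᴺ_k` be closed with `F` of degrees `d_b ≥ 1` over `k` algebraically
closed, containing the coordinate subspace `Λ_l = V₊(x_{l+1}, …, x_N)` with
`Σ_b binom(d_b, 2) < l + 1`; `B` an integral proper `k`-scheme with generic point of dimension `1`,
principal local rings at closed points and `trdeg_k k(B) = 1` (a smooth proper curve); and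
`a : Spec k(B) → X` a `k`-morphism whose image point `z₀` has dimension `1` and the same residue
field. Then `[closure z₀]` is rationally equivalent on `X` to an integral combination of LINES: a
`K`-line from `z₀` to a `K`-point `r` of `Λ_l` exists by Tsen (`exists_line_to_coordSubspace`), the
ruled surface over `B` it sweeps gives `[closure z₀] ~ pr₁_* [closure r] + (vertical lines)`
(`exists_relation_of_line`), and `pr₁_* [closure r]` is a `1`-cycle inside `Λ_l`, a multiple of a
line (`exists_zsmul_line_of_mem_coordSubspace`).
[cite: Paranjape1994SmallChow, §4.2, proof of Lemma 4.2.4]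
[cite: TianZong2014, proof of Prop. 7.2] -/
theorem exists_lines_of_birational_curve_of_coordSubspace (hN : 1 ≤ N)
    (hB1 : height (genericPoint B.left) = 1)
    (hpid : ∀ b : B.left, IsClosed ({b} : Set B.left) →
      IsPrincipalIdealRing (B.left.presheaf.stalk b))
    (htr : Algebra.trdeg k B.left.functionField = 1)
    {c : ℕ} (F : Fin c → MvPolynomial (Fin (N + 1)) k) (d : Fin c → ℕ)
    (hFhom : ∀ b, (F b).IsHomogeneous (d b)) (hd : ∀ b, 0 < d b)
    (hrange : Set.range i.left.base =
      ProjectiveSpectrum.zeroLocus (homogeneousSubmodule (Fin (N + 1)) k) (Set.range F))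
    {l : ℕ} (hl : l ≤ N) (hΛ : coordSubspace k N l ⊆ Set.range i.left.base)
    (hcount : ∑ b, (d b).choose 2 < l + 1)
    (a : Spec B.left.functionField ⟶ X.left) (ha : a ≫ X.hom = qgen B ≫ B.hom)
    (hz : height (a.base (IsLocalRing.closedPoint B.left.functionField)) = 1)
    (hasurj : Function.Surjective
      (a.residueFieldMap (IsLocalRing.closedPoint B.left.functionField))) :
    ∃ (s : Finset ↥X.left) (w : ↥X.left → ℤ), (∀ y ∈ s, IsLinePoint N i y) ∧
      IsRationallyEquivalent (primeCycle (a.base (IsLocalRing.closedPoint B.left.functionField)))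
        (∑ y ∈ s, w y • primeCycle y) 1 := by
  classical
  -- instances
  haveI : IsProper (projectiveSpace N k).hom := isProper_projectiveSpace N k
  haveI : IsProper X.hom := by rw [← Over.w i]; infer_instance
  haveI : LocallyOfFiniteType (X ⊗ B).hom :=
    inferInstanceAs (LocallyOfFiniteType (pullback.fst X.hom B.hom ≫ X.hom))
  haveI : IsProper (CartesianMonoidalCategory.fst X B).left :=
    inferInstanceAs (IsProper (pullback.fst X.hom B.hom))
  haveI : QuasiCompact (X ⊗ B).hom :=
    inferInstanceAs (QuasiCompact (pullback.fst X.hom B.hom ≫ X.hom))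
  haveI : CompactSpace ↥(X ⊗ B).left := compactSpace_of_quasiCompact_hom (X ⊗ B)
  haveI := infinite_functionField (k := k) B
  have hP := isPullback_ιX B X
  have hi := range_qgen B
  have hinjK : Function.Injective (iK N B X i).base := (iK N B X i).isClosedEmbedding.injective
  -- homogeneous coordinates `p` of the `K`-point `a`
  obtain ⟨p, hp0, hPp⟩ := exists_eq_pointOfVec (algPt N B X i a ha)
  have hptp : (pointOfVec B.left.functionField p hp0).pt = uPt N B X i a ha := by
    rw [← hPp]; rfl
  have hFp : ∀ b, eval p (MvPolynomial.map (algebraMap k B.left.functionField) (F b)) = 0 := by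
    intro b
    refine eval_eq_zero_of_mem_asHomogeneousIdeal_pt_pointOfVec hp0 (hd b) ((hFhom b).map _) ?_
    rw [hptp]
    refine map_mem_asHomogeneousIdeal_uPt N B X i a ha ?_
    have hmem : i.left.base (a.base (IsLocalRing.closedPoint B.left.functionField)) ∈
        Set.range i.left.base := ⟨_, rfl⟩
    rw [hrange] at hmem
    exact hmem ⟨b, rfl⟩
  have huXa : ∀ uX : ↥(XK B X),
      (iK N B X i).base uX = (pointOfVec B.left.functionField p hp0).pt → uX = uXPt B X a ha :=
    fun uX h => hinjK (by rw [h, hptp, iK_uXPt])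
  -- the equations vanish identically on `Λ_l`: over `k` (Nullstellensatz-free: `k` is infinite) …
  have hFΛk : ∀ b, bind₁ (restrSubst k N l) (F b) = 0 := by
    intro b
    refine MvPolynomial.funext fun y => ?_
    rw [map_zero, eval_bind₁_restrSubst]
    by_cases hy : y = 0
    · subst hy
      rw [extVec_zero, show (0 : Fin (N + 1) → k) = (0 : k) • (0 : Fin (N + 1) → k) from
        (zero_smul k _).symm, eval_smul_of_isHomogeneous (hFhom b), zero_pow (hd b).ne', zero_mul]
    · have hy0 : extVec (N := N) l y ≠ 0 := extVec_ne_zero hl hy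
      have hmem : (pointOfVec k (extVec l y) hy0).pt ∈ coordSubspace k N l := by
        rintro _ ⟨j, hj, rfl⟩
        exact mem_asHomogeneousIdeal_pt_pointOfVec hy0 one_pos (isHomogeneous_X k j)
          (by rw [eval_X]; exact extVec_apply_of_lt y hj)
      have hmemX : (pointOfVec k (extVec l y) hy0).pt ∈ Set.range i.left.base := hΛ hmem
      rw [hrange] at hmemX
      exact eval_eq_zero_of_mem_asHomogeneousIdeal_pt_pointOfVec hy0 (hd b) (hFhom b)
        (hmemX ⟨b, rfl⟩)
  -- … hence over `K`
  have hFΛK : ∀ b, bind₁ (restrSubst B.left.functionField N l)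
      (MvPolynomial.map (algebraMap k B.left.functionField) (F b)) = 0 := by
    intro b
    have h := congrArg (MvPolynomial.map (algebraMap k B.left.functionField)) (hFΛk b)
    rw [map_bind₁, map_zero] at h
    have hfun : (fun m => MvPolynomial.map (algebraMap k B.left.functionField) (restrSubst k N l m)) =
        restrSubst B.left.functionField N l :=
      funext fun m => map_restrSubst _ l m
    rwa [hfun] at h
  -- Tsen: a point `r` of `Λ_l(K)` with the line `p r` on `X_K`
  have hK : ∀ {ι : Type} [Fintype ι] (g : ι → MvPolynomial (Fin (l + 1)) B.left.functionField)
      (e : ι → ℕ), (∀ j, 0 < e j) → (∀ j, (g j).IsHomogeneous (e j)) → ∑ j, e j < l + 1 →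
      ∃ x : Fin (l + 1) → B.left.functionField, x ≠ 0 ∧ ∀ j, eval x (g j) = 0 :=
    fun g e he hg hn => Literature.FieldTheory.QuasiAlgClosed.exists_common_zero_of_trdeg_eq_one
      htr g e he hg (by simpa using hn)
  have hcount' : ∑ b, ∑ i : Fin (d b - 1), (d b - 1 - (i : ℕ)) < l + 1 := by
    rwa [Finset.sum_congr rfl fun b _ => sum_fin_sub_eq_choose (d b)]
  obtain ⟨xv, hxv0, hxv⟩ := exists_line_to_coordSubspace hK
    (F := fun b => MvPolynomial.map (algebraMap k B.left.functionField) (F b)) (d := d)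
    (fun b => (hFhom b).map _) hFΛK hcount' hFp
  set r : Fin (N + 1) → B.left.functionField := extVec l xv with hr
  have hr0 : r ≠ 0 := extVec_ne_zero hl hxv0
  have hrj : ∀ j : Fin (N + 1), l < (j : ℕ) → r j = 0 := fun j hj => extVec_apply_of_lt xv hj
  by_cases hpr : LinearIndependent B.left.functionField ![p, r]
  swap
  · -- `r` is a multiple of `p`: the curve itself lies in `Λ_l`
    obtain ⟨c₀, hc₀, hrp⟩ := exists_eq_smul_of_not_linearIndependent hp0 hr0 hpr
    have hpj : ∀ j : Fin (N + 1), l < (j : ℕ) → p j = 0 := fun j hj => by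
      have h := hrj j hj
      rw [hrp, Pi.smul_apply, smul_eq_mul, mul_eq_zero] at h
      exact h.resolve_left hc₀
    have hz₀Λ : i.left.base (a.base (IsLocalRing.closedPoint B.left.functionField)) ∈
        coordSubspace k N l := by
      rw [← fst_ιX_uXPt B X a ha]
      exact i_fst_ιX_mem_coordSubspace B X i (uXPt B X a ha) p hp0 (by rw [iK_uXPt, hptp]) hpj
    obtain ⟨y, a', hy, hrat⟩ := exists_zsmul_line_of_mem_coordSubspace X i hl hΛ hz hz₀Λ
    exact ⟨{y}, fun _ => a', by simpa using hy, by simpa using hrat⟩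
  -- the line `p r`
  obtain ⟨c', hc', uX, huX, vert, hcV, hvert⟩ := exists_relation_of_line B X i hN hB1 hpid F hrange
    ![p, r] hpr (fun b s t => hxv b s t)
  have h0 : uX 0 = uXPt B X a ha := huXa _ (huX 0)
  -- push-forward along `pr₁ : X × B → X`
  let M : AlgebraicCycle (X ⊗ B).left ℤ →+ AlgebraicCycle X.left ℤ :=
    AddMonoidHom.mk' (AlgebraicCycle.map (CartesianMonoidalCategory.fst X B).left height height)
      (algebraicCycleMap_add _ height height)
  have hMrat : ∀ c' ∈ ratTrivial (X ⊗ B).left 1, M c' ∈ ratTrivial X.left 1 :=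
    fun c' hc' => map_mem_ratTrivial_holds (d := 1) (CartesianMonoidalCategory.fst X B) hc'
  -- (i) the section through `a` pushes forward to `[z₀]`
  have hliftpt : (ιX B X).base (uXPt B X a ha) =
      (liftPt B X a ha).base (IsLocalRing.closedPoint B.left.functionField) := by
    change ((tPt B X a ha ≫ ιX B X).base _) = _
    rw [tPt_ιX]
  have hMa : M (primeCycle ((ιX B X).base (uXPt B X a ha))) =
      primeCycle (a.base (IsLocalRing.closedPoint B.left.functionField)) := by
    rw [hliftpt]
    change AlgebraicCycle.map (CartesianMonoidalCategory.fst X B).left height height _ = _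
    haveI : LocallyOfFiniteType ((CartesianMonoidalCategory.fst X B).left ≫ X.hom) :=
      inferInstanceAs (LocallyOfFiniteType (X ⊗ B).hom)
    rw [algebraicCycleMap_primeCycle_of_residueFieldMap_surjective
      (CartesianMonoidalCategory.fst X B).left X.hom ((liftPt B X a ha).base _) ?_]
    · congr 1
      change ((liftPt B X a ha ≫ (CartesianMonoidalCategory.fst X B).left).base _) = _
      rw [liftPt_fst]
    · refine residueFieldMap_surjective_of_comp (liftPt B X a ha) _ _ ?_
      have key : ∀ g : Spec B.left.functionField ⟶ X.left, g = a →
          Function.Surjective (g.residueFieldMap (IsLocalRing.closedPoint B.left.functionField)) := by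
        rintro g rfl; exact hasurj
      exact key _ (liftPt_fst B X a ha)
  -- (ii) the section through `r` pushes forward to a cycle inside `Λ_l`
  set z₁ : ↥(X ⊗ B).left := (ιX B X).base (uX 1) with hz₁
  set x₁ : ↥X.left := (CartesianMonoidalCategory.fst X B).left.base z₁ with hx₁
  have hx₁Λ : i.left.base x₁ ∈ coordSubspace k N l :=
    i_fst_ιX_mem_coordSubspace B X i (uX 1) r hr0 (huX 1) hrj
  set n₁ : ℕ := AlgebraicCycle.mapCoeff (CartesianMonoidalCategory.fst X B).left height height z₁
    with hn₁
  have hMz₁ : M (primeCycle z₁) = (n₁ : ℤ) • primeCycle x₁ := by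
    change AlgebraicCycle.map (CartesianMonoidalCategory.fst X B).left height height _ = _
    rw [algebraicCycleMap_primeCycle_eq_nsmul, natCast_zsmul]
  have hz₁1 : height z₁ = 1 := by
    let V : ClosedSubvariety (XK B X) := ClosedSubvariety.ofPoint _ (uX 1)
    have hdim := dim_image_eq hP hi hB1 V
    have hV : V.dim = 0 := by
      change height V.genericPoint = 0
      rw [ClosedSubvariety.genericPoint_ofPoint, ← height_base_eq_of_isClosedImmersion' (iK N B X i),
        huX 1]
      exact height_pt _
    have hI : (V.image (ιX B X)).dim = height z₁ := by
      change height (V.image (ιX B X)).genericPoint = _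
      rw [ClosedSubvariety.genericPoint_image, ClosedSubvariety.genericPoint_ofPoint]
    rw [← hI, hdim, hV]
    rfl
  have hn₁' : height x₁ = 1 ∨ n₁ = 0 := by
    by_cases h : height z₁ = height x₁
    · left; rw [← h, hz₁1]
    · right
      rw [hn₁, AlgebraicCycle.mapCoeff, if_neg h]
  obtain ⟨s₁, w₁, hs₁, hγ⟩ : ∃ (s₁ : Finset ↥X.left) (w₁ : ↥X.left → ℤ),
      (∀ y ∈ s₁, IsLinePoint N i y) ∧
        IsRationallyEquivalent (M (primeCycle z₁)) (∑ y ∈ s₁, w₁ y • primeCycle y) 1 := by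
    rcases hn₁' with h | h
    · obtain ⟨y₁, a₁, hy₁, hrat₁⟩ := exists_zsmul_line_of_mem_coordSubspace X i hl hΛ h hx₁Λ
      refine ⟨{y₁}, fun _ => (n₁ : ℤ) * a₁, by simpa using hy₁, ?_⟩
      rw [Finset.sum_singleton]
      change M (primeCycle z₁) - _ ∈ ratTrivial X.left 1
      rw [hMz₁, ← smul_smul, ← smul_sub]
      exact AddSubgroup.zsmul_mem _ hrat₁ _
    · refine ⟨∅, fun _ => 0, by simp, ?_⟩
      rw [Finset.sum_empty]
      change M (primeCycle z₁) - 0 ∈ ratTrivial X.left 1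
      rw [hMz₁, h, Nat.cast_zero, zero_smul, sub_zero]
      exact zero_mem _
  -- (iii) vertical parts push forward to cycles supported on lines
  obtain ⟨sv, hsv, hsupp⟩ : ∃ s : Finset ↥X.left, (∀ y ∈ s, IsLinePoint N i y) ∧
      Function.support (M vert) ⊆ s := by
    refine ⟨(finite_support_of_compactSpace vert).toFinset.image
      (CartesianMonoidalCategory.fst X B).left.base, ?_, ?_⟩
    · intro y hy
      rw [Finset.mem_image] at hy
      obtain ⟨z, hz', rfl⟩ := hy
      exact hvert z (Function.mem_support.mp ((Set.Finite.mem_toFinset _).mp hz'))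
    · exact support_map_subset _ vert _ (by rw [Set.Finite.coe_toFinset])
  -- assembling: `[z₀] = M c' + M [ι u₁] - M vert`
  let T : AlgebraicCycle X.left ℤ := (∑ y ∈ s₁, w₁ y • primeCycle y) - M vert
  have hT : Function.support T ⊆ ((s₁ ∪ sv : Finset ↥X.left) : Set ↥X.left) := by
    intro x hx
    rw [Finset.coe_union]
    have hx' : x ∈ Function.support (⇑(∑ y ∈ s₁, w₁ y • primeCycle y : AlgebraicCycle X.left ℤ)) ∪
        Function.support (⇑(M vert)) := by
      apply Function.support_sub
      rw [Function.mem_support] at hx ⊢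
      simpa only [T, Function.locallyFinsuppWithin.coe_sub, Pi.sub_apply] using hx
    rcases hx' with h | h
    · exact Or.inl (support_sum_zsmul_primeCycle_subset _ _ h)
    · exact Or.inr (hsupp h)
  refine ⟨s₁ ∪ sv, ⇑T, fun y hy => ?_, ?_⟩
  · rcases Finset.mem_union.mp hy with h | h
    · exact hs₁ y h
    · exact hsv y h
  · rw [← eq_sum_smul_primeCycle_of_support_subset T hT]
    change primeCycle _ - T ∈ ratTrivial X.left 1
    have hMc : M c' = primeCycle (a.base (IsLocalRing.closedPoint B.left.functionField)) -
        M (primeCycle z₁) + M vert := by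
      rw [hcV, map_add, map_sub, h0, hMa]
    have hrel : primeCycle (a.base (IsLocalRing.closedPoint B.left.functionField)) - T =
        M c' + (M (primeCycle z₁) - ∑ y ∈ s₁, w₁ y • primeCycle y) := by
      rw [hMc]
      simp only [T]
      abel
    rw [hrel]
    exact add_mem (hMrat c' hc') hγ

end Main

end ProjFamily

/-! ### Lines generate `CH₁` when `X` contains a large linear subspace -/

section Plane

open ProjFamily ProjectiveSpaceCells ProjectiveSpace

variable {k : Type u} [Field k] [IsAlgClosed k]

/-- **Lines generate `CH₁(X)` when `X ⊇ Λ_l` with `l ≥ Σ binom(d_a, 2)`** (coordinate form). Let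
`X ⊆ ℙᴺ_k` (`k` algebraically closed, `N ≥ 1`) be a closed subscheme with underlying set
`V₊(F₁, …, F_c)`, `F_a` forms of degrees `d_a ≥ 1`, containing the coordinate subspace
`Λ_l = V₊(x_{l+1}, …, x_N)` (`l ≤ N`), and assume `Σ_a binom(d_a, 2) < l + 1`. Then every `1`-cycle
on `X` is rationally equivalent to an integral combination of lines of `X`: apply
`ProjFamily.exists_lines_of_birational_curve_of_coordSubspace` to the normalization of each
integral curve. [cite: Paranjape1994SmallChow, §4.2, Lemma 4.2.4]
[cite: TianZong2014, Prop. 7.2 (proof)] -/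
theorem chowOneGeneratedByLines_of_coordSubspace {N : ℕ} (hN : 1 ≤ N) {X : SchemeOver k} {c : ℕ}
    (F : Fin c → MvPolynomial (Fin (N + 1)) k) (d : Fin c → ℕ) (i : X ⟶ projectiveSpace N k)
    [IsClosedImmersion i.left] (hFhom : ∀ a, (F a).IsHomogeneous (d a)) (hd : ∀ a, 0 < d a)
    (hrange : Set.range i.left.base =
      ProjectiveSpectrum.zeroLocus (homogeneousSubmodule (Fin (N + 1)) k) (Set.range F))
    {l : ℕ} (hl : l ≤ N) (hΛ : coordSubspace k N l ⊆ Set.range i.left.base)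
    (hcount : ∑ a, (d a).choose 2 < l + 1) :
    ChowOneGeneratedByLines N i := by
  haveI : IsProper (projectiveSpace N k).hom := isProper_projectiveSpace N k
  haveI : IsProper X.hom := by rw [← Over.w i]; infer_instance
  haveI : CompactSpace ↥X.left := compactSpace_of_quasiCompact_hom X
  refine ChowOneGeneratedByLines.of_primeCycle fun z hz => ?_
  haveI := ProjFamily.isProper_curveB X z
  have h := ProjFamily.exists_lines_of_birational_curve_of_coordSubspace (ProjFamily.curveB X z) X i
    hN (ProjFamily.height_genericPoint_curveB hz)
    (fun b _ => ProjFamily.isPrincipalIdealRing_stalk_curveB hz b) (ProjFamily.trdeg_curveB hz)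
    F d hFhom hd hrange hl hΛ hcount (ProjFamily.curveA X z) (ProjFamily.curveA_comp_hom X z)
    (by rw [ProjFamily.curveA_apply]; exact hz) (ProjFamily.residueFieldMap_curveA_surjective _)
  rwa [ProjFamily.curveA_apply] at h

/-- **Lines generate `CH₁(X)` when `X` contains a linear subspace of dimension `≥ Σ binom(d_a, 2)`**
(Paranjape's linear-space mechanism, explicit one-dimensional case, in Tian–Zong's product-trick
form). Let `k` be algebraically closed, `X ⊆ ℙᴺ_k` (`N ≥ 1`) a closed subscheme with underlying
set `V₊(F₁, …, F_c)` for forms `F_a` of degrees `d_a ≥ 1`, and let `L₁, …, L_t` be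
linearly independent linear forms with `V₊(L) ⊆ X` (so `X` contains the linear subspace
`Λ = V₊(L) ≅ ℙ^{N-t}`). If `Σ_a binom(d_a, 2) + t < N + 1` then every `1`-cycle on `X` is
rationally equivalent to an integral combination of lines of `X` (`ChowOneGeneratedByLines N i`). In
the setting of the named fact `TianZong2014_chowOne_generatedByLines` (`N = n + c`, smooth complete
intersections) this is the case of an `X` containing a `ℙˡ` with `l ≥ Σ_a binom(d_a, 2)` — e.g. a
cubic hypersurface containing a `ℙ³`, an intersection of two quadrics containing a plane — not
covered by `Σ d_a² ≤ n + c` (`Motives/LinesGenerateChowOneSumSq`). Reduction to the coordinate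
subspace by the projective linear transformation taking `L` to the last `t` variables
(`Motives/ProjectiveSpaceLinearSubst`). [cite: Paranjape1994SmallChow, §4.2, Lemma 4.2.4]
[cite: TianZong2014, Prop. 7.2 (proof), Thm. 1.7] -/
theorem chowOneGeneratedByLines_of_linearSubspace {N : ℕ} (hN : 1 ≤ N) {X : SchemeOver k} {c : ℕ}
    (F : Fin c → MvPolynomial (Fin (N + 1)) k) (d : Fin c → ℕ) (i : X ⟶ projectiveSpace N k)
    [IsClosedImmersion i.left] (hFhom : ∀ a, (F a).IsHomogeneous (d a)) (hd : ∀ a, 0 < d a)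
    (hrange : Set.range i.left.base =
      ProjectiveSpectrum.zeroLocus (homogeneousSubmodule (Fin (N + 1)) k) (Set.range F))
    {t : ℕ} (L : Fin t → MvPolynomial (Fin (N + 1)) k) (hL : LinearIndependent k L)
    (hLhom : ∀ j, (L j).IsHomogeneous 1)
    (hΛ : ProjectiveSpectrum.zeroLocus (homogeneousSubmodule (Fin (N + 1)) k) (Set.range L) ⊆
      Set.range i.left.base)
    (hcount : ∑ a, (d a).choose 2 + t < N + 1) :
    ChowOneGeneratedByLines N i := by
  classical
  have htN : t ≤ N := by omega
  -- the change of coordinates taking `L` to `x_{N-t+1}, …, x_N`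
  let w : Fin t → (Fin (N + 1) → k) := fun a j ↦ MvPolynomial.coeff (Finsupp.single j 1) (L a)
  have hwL : ∀ a, lin (w a) = L a := fun a ↦ (eq_lin_of_isHomogeneous_one (hLhom a)).symm
  have hw : LinearIndependent k w := by
    refine LinearIndependent.of_comp linMap ?_
    have : ⇑linMap ∘ w = L := funext fun a ↦ hwL a
    rw [this]; exact hL
  obtain ⟨b, hb⟩ := exists_basis_extending w hw (m := N + 1 - t) (by omega)
  obtain ⟨τ', hτ, hτ', hinv, hinv', -⟩ := exists_linearSubst_of_basis b
  have hτL : ∀ a : Fin t, lin (b ⟨N + 1 - t + a, by omega⟩) = L a := fun a ↦ by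
    rw [hb a, hwL a]
  -- the projective linear transformation `σ` and its inverse `σ'`, on `Proj k[x₀, …, x_N]`
  let σ : Proj (homogeneousSubmodule (Fin (N + 1)) k) ⟶ Proj (homogeneousSubmodule (Fin (N + 1)) k) :=
    ProjectiveSpace.substMapHom (fun j ↦ lin (b j)) hτ τ' hτ' hinv
  let σ' : Proj (homogeneousSubmodule (Fin (N + 1)) k) ⟶ Proj (homogeneousSubmodule (Fin (N + 1)) k) :=
    ProjectiveSpace.substMapHom τ' hτ' (fun j ↦ lin (b j)) hτ hinv'
  haveI : IsIso σ := isIso_substMapHom _ hτ τ' hτ' hinv hinv'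
  have hσσ' : σ ≫ σ' = 𝟙 _ := substMapHom_comp_substMapHom _ hτ τ' hτ' hinv hinv'
  have hσ'σ : σ' ≫ σ = 𝟙 _ := substMapHom_comp_substMapHom τ' hτ' _ hτ hinv' hinv
  have h1 : ∀ x, σ'.base (σ.base x) = x := fun x ↦ by
    simpa using congrArg (fun f ↦ f.base x) hσσ'
  have h2 : ∀ y, σ.base (σ'.base y) = y := fun y ↦ by
    simpa using congrArg (fun f ↦ f.base y) hσ'σ
  -- images under `σ` are preimages under `σ'`
  have himage : ∀ S : Set ↥(Proj (homogeneousSubmodule (Fin (N + 1)) k)),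
      σ.base '' S = σ'.base ⁻¹' S := by
    intro S
    ext y
    constructor
    · rintro ⟨x, hx, rfl⟩
      rw [Set.mem_preimage, h1]; exact hx
    · intro hy
      exact ⟨σ'.base y, hy, h2 y⟩
  -- the new embedding `e = i ≫ σ`
  let i' : X.left ⟶ Proj (homogeneousSubmodule (Fin (N + 1)) k) := i.left
  haveI : IsClosedImmersion i' := ‹IsClosedImmersion i.left›
  let e : X.left ⟶ Proj (homogeneousSubmodule (Fin (N + 1)) k) := i' ≫ σ
  haveI : IsClosedImmersion e := inferInstanceAs (IsClosedImmersion (i' ≫ σ))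
  let i₁ : X ⟶ projectiveSpace N k := i ≫ ProjectiveSpace.substMap (fun j ↦ lin (b j)) hτ τ' hτ' hinv
  have hi₁ : i₁.left = e := rfl
  haveI : IsClosedImmersion i₁.left := inferInstanceAs (IsClosedImmersion (i' ≫ σ))
  -- its image is `V₊(σ_{τ'} F)`
  let F' : Fin c → MvPolynomial (Fin (N + 1)) k := fun a ↦ MvPolynomial.aeval τ' (F a)
  have hF'hom : ∀ a, (F' a).IsHomogeneous (d a) := fun a ↦ by
    have h := (hFhom a).aeval τ' hτ'
    rwa [one_mul] at h
  have hrangei' : Set.range i'.base =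
      ProjectiveSpectrum.zeroLocus (homogeneousSubmodule (Fin (N + 1)) k) (Set.range F) := hrange
  have hrange₁ : Set.range i₁.left.base =
      ProjectiveSpectrum.zeroLocus (homogeneousSubmodule (Fin (N + 1)) k) (Set.range F') := by
    rw [hi₁]
    change Set.range (i' ≫ σ).base = _
    rw [Scheme.Hom.comp_base, TopCat.coe_comp, Set.range_comp, hrangei', himage,
      substMapHom_preimage_zeroLocus, ← Set.range_comp]
    rfl
  -- `σ⁻¹ Λ_{N-t} = V₊(L)`, so `Λ_{N-t} ⊆ e(X)`
  have hpre : σ.base ⁻¹' coordSubspace k N (N - t) =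
      ProjectiveSpectrum.zeroLocus (homogeneousSubmodule (Fin (N + 1)) k) (Set.range L) := by
    change σ.base ⁻¹' ProjectiveSpectrum.zeroLocus _ _ = _
    rw [substMapHom_preimage_zeroLocus]
    congr 1
    ext f
    simp only [Set.mem_image, Set.mem_setOf_eq, Set.mem_range, exists_exists_and_eq_and,
      MvPolynomial.aeval_X]
    constructor
    · rintro ⟨j, hj, rfl⟩
      refine ⟨⟨j - (N + 1 - t), by omega⟩, ?_⟩
      rw [← hτL]
      congr 2
      exact Fin.ext (by simp; omega)
    · rintro ⟨a, rfl⟩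
      exact ⟨⟨N + 1 - t + a, by omega⟩, by simp; omega, hτL a⟩
  have hΛi' : ProjectiveSpectrum.zeroLocus (homogeneousSubmodule (Fin (N + 1)) k) (Set.range L) ⊆
      Set.range i'.base := hΛ
  have hΛ₁ : coordSubspace k N (N - t) ⊆ Set.range i₁.left.base := by
    rw [hi₁]
    intro y hy
    have h3 : σ'.base y ∈ σ.base ⁻¹' coordSubspace k N (N - t) := by
      rw [Set.mem_preimage, h2]; exact hy
    rw [hpre] at h3
    obtain ⟨x, hx⟩ := hΛi' h3
    refine ⟨x, ?_⟩
    change (i' ≫ σ).base x = y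
    rw [Scheme.Hom.comp_base, TopCat.coe_comp, Function.comp_apply, hx, h2]
  -- the coordinate case for `i₁`
  have h₁ : ChowOneGeneratedByLines N i₁ :=
    chowOneGeneratedByLines_of_coordSubspace hN F' d i₁ hF'hom hd hrange₁ (Nat.sub_le N t) hΛ₁
      (by omega)
  -- transfer of line points from `i₁` back to `i`
  have hinj : Function.Injective
      (MvPolynomial.aeval (fun j ↦ lin (b j)) : MvPolynomial (Fin (N + 1)) k →ₐ[k] _) :=
    Function.LeftInverse.injective hinv'
  have transfer : ∀ y : ↥X.left, IsLinePoint N i₁ y → IsLinePoint N i y := by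
    rintro y ⟨hy, L₁, hL₁, hL₁hom, hcl⟩
    refine ⟨hy, fun j ↦ MvPolynomial.aeval (fun j ↦ lin (b j)) (L₁ j), ?_, fun j ↦ ?_, ?_⟩
    · exact hL₁.map' (MvPolynomial.aeval fun j ↦ lin (b j)).toLinearMap (LinearMap.ker_eq_bot.mpr hinj)
    · have h := (hL₁hom j).aeval (fun j ↦ lin (b j)) hτ
      rwa [one_mul] at h
    · rw [hi₁] at hcl
      have hcl' : ⇑e.base '' closure {y} = ProjectiveSpectrum.zeroLocus
          (homogeneousSubmodule (Fin (N + 1)) k) (Set.range L₁) := hcl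
      have himg : ⇑i'.base '' closure {y} = σ.base ⁻¹' (e.base '' closure {y}) := by
        change _ = σ.base ⁻¹' ((i' ≫ σ).base '' closure {y})
        rw [Scheme.Hom.comp_base, TopCat.coe_comp, Set.image_comp]
        exact (Set.preimage_image_eq _ σ.isClosedEmbedding.injective).symm
      change ⇑i'.base '' closure {y} = _
      rw [himg, hcl', substMapHom_preimage_zeroLocus, ← Set.range_comp]
      rfl
  intro γ hγ
  obtain ⟨s, w', hs, hrat⟩ := h₁ γ hγ
  exact ⟨s, w', fun z hz ↦ transfer z (hs z hz), hrat⟩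

end Plane

end Literature.AlgebraicGeometry.Motives

end
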